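import Literature.Probability.RandomPlanarGeometry.SAWCount
import HarnessLib

/-!
# Self-avoiding walk on `ℤ^d`: the weakly self-avoiding weights and the mean-square
# displacement are non-degenerate — proofs

Sibling proof file of `Literature.Probability.RandomPlanarGeometry.BDGS2012` (objects
`walkWeight lam p = ∏_{0 ≤ s < t ≤ n}(1 + λU_{st}(ω))`, `weaklyCountAt d lam n x = cₙ^{(λ)}(x)`,
`weaklyCount d lam n = cₙ^{(λ)}`, `weaklyExpectation d lam n X = 𝔼ₙ^{(λ)} X`,
`meanSqDisplacement d lam n = 𝔼ₙ^{(λ)}|ω(n)|²`, `HasDisplacementExponent`,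
`DisplacementExponentConjecture2D`; source R. Bauerschmidt, H. Duminil-Copin, J. Goodman,
G. Slade, *Lectures on self-avoiding walks*, Clay Math. Proc. 15 (2012), arXiv:1206.2092,
§1.2 and §1.5.2), on top of `SAWCount.lean` (`one_le_count : 1 ≤ cₙ`).

Everything here is PROVED (no named facts). Purpose: the expectation `𝔼ₙ^{(λ)}` of BDGS (1.9)
is formalised with Lean's `0⁻¹ = 0` convention for the normalisation `(cₙ^{(λ)})⁻¹`; this file
shows that for the parameter range `λ ≤ 1` of the source (`λ ∈ [0,1]`) no junk value occurs and
that the mean-square displacement of (1.27) obeys the trivial bounds, so that the conjecture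
`DisplacementExponentConjecture2D` (`ν = 3/4`, BDGS (1.28); an OPEN problem — "Almost nothing
is known rigorously about `ν` in dimensions 2, 3, 4", BDGS §1.5.2) is neither vacuously true
nor vacuously false as stated. Nothing here is progress on `ν`.

## Contents (namespace `Literature.Probability.RandomPlanarGeometry.SAW.Zd`)

* weights (any simple graph): `walkWeight_nonneg` (`λ ≤ 1`), `walkWeight_le_walkWeight`
  (`λ ↦ walkWeight λ ω` is antitone on `(-∞, 1]`), `walkWeight_le_one` (`0 ≤ λ ≤ 1`),
  `walkWeight_of_isPath` (a self-avoiding walk has weight `1` for every `λ`),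
  `ite_isPath_le_walkWeight` (`𝟙{ω SAW} ≤ weight`, `λ ≤ 1`);
* counts on `ℤ^d`: `countAt_le_weaklyCountAt`, `count_le_weaklyCount` (`cₙ ≤ cₙ^{(λ)}` for
  `λ ≤ 1`, BDGS §1.2: "self-intersections are penalised but not forbidden"),
  `weaklyCountAt_nonneg`, `weaklyCount_nonneg`, **`weaklyCount_pos`** (`cₙ^{(λ)} ≥ cₙ ≥ 1 > 0`
  for `d ≥ 1`, `λ ≤ 1`: the normalisation in (1.9) is a genuine one);
* geometry: `sum_abs_sub_le_length` (the `ℓ¹`-distance between the endpoints of a walk is at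
  most its length), `normSq_le_sq_length` (`|ω(n)|² ≤ n²`), `one_le_normSq_of_ne_zero`
  (`|x|² ≥ 1` for `x ∈ ℤ^d ∖ {0}`);
* mean-square displacement: `meanSqDisplacement_nonneg`, **`meanSqDisplacement_le_sq`**
  (`𝔼ₙ^{(λ)}|ω(n)|² ≤ n²`, the trivial ballistic bound, `λ ≤ 1`),
  **`meanSqDisplacement_pos`** (`𝔼ₙ^{(λ)}|ω(n)|² > 0` for `n ≥ 1`, `d ≥ 1`, `λ ≤ 1`: every
  `n`-step self-avoiding walk has weight `1` and ends at a site `x ≠ 0`, `|x|² ≥ 1`), and the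
  `λ = 1` lower bound `one_le_meanSqDisplacement_one` (`𝔼ₙ|ω(n)|² ≥ 1`, `n ≥ 1`).

BDGS §1.5.2 records that even `c n ≤ 𝔼ₙ|ω(n)|² ≤ C n^{2-ε}` is open in `d = 2, 3, 4`; the
bounds here are the elementary `0 < 𝔼ₙ^{(λ)}|ω(n)|² ≤ n²` only.

## References

* R. Bauerschmidt, H. Duminil-Copin, J. Goodman, G. Slade, *Lectures on self-avoiding walks*,
  Clay Math. Proc. 15 (2012), 395–467, arXiv:1206.2092: §1.2 (1.4)–(1.9), §1.5.2
  (1.27)–(1.28).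
* N. Madras, G. Slade, *The Self-Avoiding Walk*, Birkhäuser 1993, §1.1.
-/

noncomputable section

open Finset SimpleGraph Literature.Probability.LatticeModels Literature.Probability.Percolation
open scoped BigOperators

namespace Literature.Probability.RandomPlanarGeometry.SAW.Zd

/-! ### The self-intersection weight for `λ ≤ 1` -/

section Weight

variable {V : Type*} [DecidableEq V] {G : SimpleGraph V} {u v : V}

/-- Each factor `1 + λU_{st}(ω) = 1 - λ𝟙{ω(s) = ω(t)}` is non-negative when `λ ≤ 1`.
[cite: BDGS2012, §1.2, eqs. (1.4)–(1.5)] -/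
theorem walkWeight_factor_nonneg {lam : ℝ} (h1 : lam ≤ 1) (p : G.Walk u v) (s t : ℕ) :
    0 ≤ 1 - lam * (if p.getVert s = p.getVert t then (1 : ℝ) else 0) := by
  split_ifs <;> linarith

/-- For `λ ≤ 1` the weight `∏_{s<t}(1 + λU_{st}(ω))` is non-negative ("for `λ ∈ (0,1)`
self-intersections are penalised but not forbidden"). [cite: BDGS2012, §1.2, eqs. (1.4)–(1.5)] -/
theorem walkWeight_nonneg {lam : ℝ} (h1 : lam ≤ 1) (p : G.Walk u v) : 0 ≤ walkWeight lam p := by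
  unfold walkWeight
  exact prod_nonneg fun s _ => prod_nonneg fun t _ => walkWeight_factor_nonneg h1 p s t

/-- The weight is antitone in `λ` on `(-∞, 1]`: a larger repulsion parameter penalises every
self-intersection more. [cite: BDGS2012, §1.2, eqs. (1.4)–(1.5)] -/
theorem walkWeight_le_walkWeight {lam lam' : ℝ} (h : lam ≤ lam') (h1 : lam' ≤ 1)
    (p : G.Walk u v) : walkWeight lam' p ≤ walkWeight lam p := by
  unfold walkWeight
  refine prod_le_prod (fun s _ => prod_nonneg fun t _ => walkWeight_factor_nonneg h1 p s t)
    fun s _ => ?_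
  refine prod_le_prod (fun t _ => walkWeight_factor_nonneg h1 p s t) fun t _ => ?_
  split_ifs <;> linarith

/-- For `0 ≤ λ ≤ 1` the weight lies in `[0, 1]`. [cite: BDGS2012, §1.2, eqs. (1.4)–(1.5)] -/
theorem walkWeight_le_one {lam : ℝ} (h0 : 0 ≤ lam) (h1 : lam ≤ 1) (p : G.Walk u v) :
    walkWeight lam p ≤ 1 := by
  unfold walkWeight
  refine prod_le_one (fun s _ => prod_nonneg fun t _ => walkWeight_factor_nonneg h1 p s t)
    fun s _ => ?_
  refine prod_le_one (fun t _ => walkWeight_factor_nonneg h1 p s t) fun t _ => ?_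
  split_ifs <;> linarith

/-- A self-avoiding walk has weight `1` for every `λ` (all the indicators `𝟙{ω(s) = ω(t)}`,
`s < t`, vanish). [cite: BDGS2012, §1.2] -/
theorem walkWeight_of_isPath (lam : ℝ) {p : G.Walk u v} (hp : p.IsPath) :
    walkWeight lam p = 1 := by
  unfold walkWeight
  refine prod_eq_one fun s hs => prod_eq_one fun t ht => ?_
  have hs' : s ≤ p.length := Nat.lt_succ_iff.mp (mem_range.mp hs)
  obtain ⟨hst, ht'⟩ := mem_Ioc.mp ht
  have hne : p.getVert s ≠ p.getVert t := fun h =>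
    absurd (hp.getVert_injOn (by simpa using hs') (by simpa using ht') h) hst.ne
  simp [hne]

/-- For `λ ≤ 1` the weight dominates the indicator of self-avoidance (its value at `λ = 1`,
`walkWeight_one`). [cite: BDGS2012, §1.2] -/
theorem ite_isPath_le_walkWeight {lam : ℝ} (h1 : lam ≤ 1) (p : G.Walk u v) :
    (if p.IsPath then (1 : ℝ) else 0) ≤ walkWeight lam p := by
  rw [← walkWeight_one]
  exact walkWeight_le_walkWeight h1 le_rfl p

end Weight

/-! ### `cₙ ≤ cₙ^{(λ)}` and `cₙ^{(λ)} > 0` for `λ ≤ 1` -/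

section Zd

variable {d : ℕ}

/-- `cₙ(x) ≤ cₙ^{(λ)}(x)` for `λ ≤ 1`. [cite: BDGS2012, §1.2, eq. (1.7)] -/
theorem countAt_le_weaklyCountAt {lam : ℝ} (h1 : lam ≤ 1) (n : ℕ) (x : Site d) :
    (countAt d n x : ℝ) ≤ weaklyCountAt d lam n x := by
  rw [← weaklyCountAt_one]
  unfold weaklyCountAt
  exact sum_le_sum fun p _ => walkWeight_le_walkWeight h1 le_rfl p

/-- `cₙ ≤ cₙ^{(λ)}` for `λ ≤ 1`. [cite: BDGS2012, §1.2, eq. (1.7)] -/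
theorem count_le_weaklyCount {lam : ℝ} (h1 : lam ≤ 1) (n : ℕ) :
    (count d n : ℝ) ≤ weaklyCount d lam n := by
  rw [count, Nat.cast_sum, weaklyCount]
  exact sum_le_sum fun x _ => countAt_le_weaklyCountAt h1 n x

/-- `cₙ^{(λ)}(x) ≥ 0` for `λ ≤ 1`. [cite: BDGS2012, §1.2, eq. (1.7)] -/
theorem weaklyCountAt_nonneg {lam : ℝ} (h1 : lam ≤ 1) (n : ℕ) (x : Site d) :
    0 ≤ weaklyCountAt d lam n x := by
  unfold weaklyCountAt
  exact sum_nonneg fun p _ => walkWeight_nonneg h1 p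

/-- `cₙ^{(λ)} ≥ 0` for `λ ≤ 1`. [cite: BDGS2012, §1.2, eq. (1.7)] -/
theorem weaklyCount_nonneg {lam : ℝ} (h1 : lam ≤ 1) (n : ℕ) : 0 ≤ weaklyCount d lam n := by
  unfold weaklyCount
  exact sum_nonneg fun x _ => weaklyCountAt_nonneg h1 n x

/-- **`cₙ^{(λ)} > 0`** on `ℤ^d`, `d ≥ 1`, for `λ ≤ 1` (indeed `cₙ^{(λ)} ≥ cₙ ≥ 1`): the
normalisation `(cₙ^{(λ)})⁻¹` in the expectation (1.9) is never Lean's junk `0⁻¹`.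
[cite: BDGS2012, §1.2, eqs. (1.7)–(1.9)] -/
theorem weaklyCount_pos [NeZero d] {lam : ℝ} (h1 : lam ≤ 1) (n : ℕ) :
    0 < weaklyCount d lam n :=
  lt_of_lt_of_le (by exact_mod_cast one_le_count d n) (count_le_weaklyCount h1 n)

/-! ### The endpoint of an `n`-step walk: `|ω(n)|² ≤ n²`, and `|x|² ≥ 1` off the origin -/

/-- One nearest-neighbour step changes the `ℓ¹`-position by exactly `1`. [folklore] -/
theorem sum_abs_sub_eq_one_of_adj {x y : Site d} (h : (zdGraph d).Adj x y) :
    ∑ i, |y i - x i| = 1 := by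
  have key : ∀ (z w : Site d) (i : Fin d), w = z + Pi.single i 1 → ∑ j, |w j - z j| = 1 := by
    rintro z w i rfl
    calc ∑ j, |(z + Pi.single i (1 : ℤ) : Site d) j - z j| = ∑ j, (if j = i then (1 : ℤ) else 0) :=
          sum_congr rfl fun j _ => by
            by_cases hji : j = i
            · subst hji; simp
            · simp [hji]
      _ = 1 := by simp
  obtain ⟨i, h | h⟩ := (zdGraph_adj_iff x y).1 h
  · exact key x y i h
  · rw [← key y x i h]
    exact sum_congr rfl fun j _ => abs_sub_comm _ _

/-- The `ℓ¹`-distance between the endpoints of a nearest-neighbour walk on `ℤ^d` is at most its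
length. [folklore] -/
theorem sum_abs_sub_le_length {u x : Site d} (p : (zdGraph d).Walk u x) :
    ∑ i, |x i - u i| ≤ p.length := by
  induction p with
  | nil => simp
  | cons h q ih =>
    rename_i a b c
    rw [Walk.length_cons, Nat.cast_succ]
    calc ∑ i, |c i - a i| ≤ ∑ i, (|c i - b i| + |b i - a i|) :=
          sum_le_sum fun i _ => by
            calc |c i - a i| = |(c i - b i) + (b i - a i)| := by ring_nf
              _ ≤ |c i - b i| + |b i - a i| := abs_add_le _ _
      _ = ∑ i, |c i - b i| + ∑ i, |b i - a i| := sum_add_distrib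
      _ ≤ q.length + 1 := add_le_add ih (sum_abs_sub_eq_one_of_adj h).le

/-- `|x|² ≥ 0`. [folklore] -/
theorem normSq_nonneg (x : Site d) : 0 ≤ normSq x :=
  sum_nonneg fun _ _ => sq_nonneg _

/-- `|x|² ≤ ‖x‖₁²` (coordinatewise `xᵢ² = |xᵢ|·|xᵢ| ≤ |xᵢ|·‖x‖₁`). [folklore] -/
theorem normSq_le_sq_sum_abs (x : Site d) : normSq x ≤ (∑ i, |(x i : ℝ)|) ^ 2 := by
  have hS : ∀ i, |(x i : ℝ)| ≤ ∑ j, |(x j : ℝ)| := fun i =>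
    single_le_sum (f := fun j => |(x j : ℝ)|) (fun j _ => abs_nonneg _) (mem_univ i)
  calc normSq x = ∑ i, |(x i : ℝ)| * |(x i : ℝ)| := by
        simp only [normSq, abs_mul_abs_self, sq]
    _ ≤ ∑ i, |(x i : ℝ)| * ∑ j, |(x j : ℝ)| :=
        sum_le_sum fun i _ => mul_le_mul_of_nonneg_left (hS i) (abs_nonneg _)
    _ = (∑ i, |(x i : ℝ)|) ^ 2 := by rw [← sum_mul, sq]

/-- **`|ω(n)|² ≤ n²`**: the endpoint of an `n`-step walk from the origin has squared Euclidean
norm at most `n²`. [folklore] -/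
theorem normSq_le_sq_length {x : Site d} (p : (zdGraph d).Walk (0 : Site d) x) :
    normSq x ≤ (p.length : ℝ) ^ 2 := by
  have h1 : ∑ i, |x i| ≤ (p.length : ℤ) := by simpa using sum_abs_sub_le_length p
  have h1' : ∑ i, |(x i : ℝ)| ≤ (p.length : ℝ) := by
    have := (Int.cast_le (R := ℝ)).2 h1
    push_cast at this
    exact this
  have hS : (0 : ℝ) ≤ ∑ i, |(x i : ℝ)| := sum_nonneg fun i _ => abs_nonneg _
  exact (normSq_le_sq_sum_abs x).trans (pow_le_pow_left₀ hS h1' 2)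

/-- `|x|² ≥ 1` for a lattice site `x ≠ 0`. [folklore] -/
theorem one_le_normSq_of_ne_zero {x : Site d} (hx : x ≠ 0) : 1 ≤ normSq x := by
  obtain ⟨i, hi⟩ : ∃ i, x i ≠ 0 := Function.ne_iff.1 hx
  have h1 : (1 : ℝ) ≤ ((x i : ℝ)) ^ 2 := by
    rw [one_le_sq_iff_one_le_abs]
    exact_mod_cast Int.one_le_abs hi
  exact h1.trans (single_le_sum (f := fun j => ((x j : ℝ)) ^ 2) (fun j _ => sq_nonneg _)
    (mem_univ i))

/-- A self-avoiding walk of positive length from the origin does not end at the origin.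
[folklore] -/
theorem ne_zero_of_isPath {x : Site d} {p : (zdGraph d).Walk (0 : Site d) x} (hp : p.IsPath)
    (hn : p.length ≠ 0) : x ≠ 0 := by
  rintro rfl
  exact hn (Walk.length_eq_zero_iff.2 (Walk.isPath_iff_nil.1 hp))

/-! ### The mean-square displacement: `0 < 𝔼ₙ^{(λ)}|ω(n)|² ≤ n²` -/

/-- The un-normalised sum `Σ_ω |ω(n)|² · weight(ω)` is at most `n² cₙ^{(λ)}` (`λ ≤ 1`).
[cite: BDGS2012, §1.5.2, eq. (1.27)] -/
theorem sum_normSq_mul_walkWeight_le {lam : ℝ} (h1 : lam ≤ 1) (n : ℕ) :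
    ∑ x ∈ box d n, ∑ p ∈ (zdGraph d).finsetWalkLength n (0 : Site d) x,
        normSq x * walkWeight lam p ≤ (n : ℝ) ^ 2 * weaklyCount d lam n := by
  rw [weaklyCount, mul_sum]
  refine sum_le_sum fun x _ => ?_
  rw [weaklyCountAt, mul_sum]
  refine sum_le_sum fun p hp => mul_le_mul_of_nonneg_right ?_ (walkWeight_nonneg h1 p)
  have := normSq_le_sq_length p
  rwa [(mem_finsetWalkLength_iff).1 hp] at this

/-- For `λ ≤ 1`, the un-normalised sum `Σ_ω |ω(n)|² · weight(ω)` is at least `cₙ` when `n ≥ 1`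
(every self-avoiding walk has weight `1` and `|ω(n)|² ≥ 1`). [cite: BDGS2012, §1.5.2] -/
theorem count_le_sum_normSq_mul_walkWeight {lam : ℝ} (h1 : lam ≤ 1) {n : ℕ} (hn : n ≠ 0) :
    (count d n : ℝ) ≤ ∑ x ∈ box d n, ∑ p ∈ (zdGraph d).finsetWalkLength n (0 : Site d) x,
        normSq x * walkWeight lam p := by
  classical
  rw [count, Nat.cast_sum]
  refine sum_le_sum fun x _ => ?_
  rw [countAt, card_filter, Nat.cast_sum]
  refine sum_le_sum fun p hp => ?_
  have hlen : p.length = n := (mem_finsetWalkLength_iff).1 hp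
  split_ifs with hpath
  · have hx : x ≠ 0 := ne_zero_of_isPath hpath (hlen ▸ hn)
    rw [walkWeight_of_isPath lam hpath, mul_one, Nat.cast_one]
    exact one_le_normSq_of_ne_zero hx
  · rw [Nat.cast_zero]
    exact mul_nonneg (normSq_nonneg x) (walkWeight_nonneg h1 p)

/-- `𝔼ₙ^{(λ)}|ω(n)|² ≥ 0` for `λ ≤ 1`. [cite: BDGS2012, §1.5.2, eq. (1.27)] -/
theorem meanSqDisplacement_nonneg {lam : ℝ} (h1 : lam ≤ 1) (n : ℕ) :
    0 ≤ meanSqDisplacement d lam n := by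
  unfold meanSqDisplacement weaklyExpectation
  exact mul_nonneg (inv_nonneg.2 (weaklyCount_nonneg h1 n))
    (sum_nonneg fun x _ => sum_nonneg fun p _ =>
      mul_nonneg (normSq_nonneg x) (walkWeight_nonneg h1 p))

/-- **`𝔼ₙ^{(λ)}|ω(n)|² ≤ n²`** for `λ ≤ 1`: the trivial (ballistic) upper bound on the
mean-square displacement; BDGS §1.5.2 records that the improvement `≤ C n^{2-ε}` is open in
`d = 2, 3, 4`. [cite: BDGS2012, §1.5.2, eq. (1.27)] -/
theorem meanSqDisplacement_le_sq {lam : ℝ} (h1 : lam ≤ 1) (n : ℕ) :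
    meanSqDisplacement d lam n ≤ (n : ℝ) ^ 2 := by
  unfold meanSqDisplacement weaklyExpectation
  have hW := weaklyCount_nonneg (d := d) h1 n
  calc (weaklyCount d lam n)⁻¹ * ∑ x ∈ box d n,
          ∑ p ∈ (zdGraph d).finsetWalkLength n (0 : Site d) x, normSq x * walkWeight lam p
        ≤ (weaklyCount d lam n)⁻¹ * ((n : ℝ) ^ 2 * weaklyCount d lam n) :=
          mul_le_mul_of_nonneg_left (sum_normSq_mul_walkWeight_le h1 n) (inv_nonneg.2 hW)
    _ ≤ (n : ℝ) ^ 2 := by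
          rcases hW.eq_or_lt with h | h
          · rw [← h]; simp only [inv_zero, zero_mul]; positivity
          · rw [mul_comm, mul_assoc, mul_inv_cancel₀ h.ne', mul_one]

/-- **`𝔼ₙ^{(λ)}|ω(n)|² > 0`** on `ℤ^d`, `d ≥ 1`, for `λ ≤ 1` and `n ≥ 1` (indeed
`≥ cₙ / cₙ^{(λ)}`): the quantity in (1.27) is not degenerate, so `HasDisplacementExponent` /
`DisplacementExponentConjecture2D` are not vacuously false. [cite: BDGS2012, §1.5.2, eq. (1.27)] -/
theorem meanSqDisplacement_pos [NeZero d] {lam : ℝ} (h1 : lam ≤ 1) {n : ℕ} (hn : n ≠ 0) :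
    0 < meanSqDisplacement d lam n := by
  unfold meanSqDisplacement weaklyExpectation
  refine mul_pos (inv_pos.2 (weaklyCount_pos h1 n)) (lt_of_lt_of_le ?_
    (count_le_sum_normSq_mul_walkWeight h1 hn))
  exact_mod_cast one_le_count d n

/-- **`𝔼ₙ|ω(n)|² ≥ 1`** for the strictly self-avoiding walk (`λ = 1`), `n ≥ 1`, `d ≥ 1`: every
`n`-step self-avoiding walk ends at a site `x ≠ 0`, and `|x|² ≥ 1` on `ℤ^d ∖ {0}`; BDGS §1.5.2
records that already `𝔼ₙ|ω(n)|² ≥ c n` is open in `d = 2, 3, 4`. [cite: BDGS2012, §1.5.2] -/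
theorem one_le_meanSqDisplacement_one [NeZero d] {n : ℕ} (hn : n ≠ 0) :
    1 ≤ meanSqDisplacement d 1 n := by
  unfold meanSqDisplacement weaklyExpectation
  have hW : 0 < weaklyCount d 1 n := weaklyCount_pos le_rfl n
  rw [weaklyCount_one] at hW ⊢
  rw [le_inv_mul_iff₀ hW, mul_one]
  exact count_le_sum_normSq_mul_walkWeight le_rfl hn

end Zd

end Literature.Probability.RandomPlanarGeometry.SAW.Zd
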